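import Literature.NumberTheory.EllipticCurves.SteinWuthrich2013.MultiplicativeHeightExistence
import Literature.NumberTheory.EllipticCurves.CanonicalPAdicHeightLeavesProofs
import Literature.NumberTheory.EllipticCurves.CanonicalPAdicHeightThetaProofs
import Literature.NumberTheory.EllipticCurves.FormalGroupPadicLogPointProofs
import Literature.NumberTheory.EllipticCurves.FormalGroupLawPadicProofs
import HarnessLib

/-!
# Stein–Wuthrich 2013 §4.2: the `p`-adic height at a MULTIPLICATIVE prime EXISTS as soon as the
# Tate sigma quantity satisfies the theta relation at rational points (proofs only)

Topic `Literature/NumberTheory/EllipticCurves` (cluster `SteinWuthrich2013`); proof file (theorems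
only, nothing asserted, no definition) behind the two NAMED FACTS of
`MultiplicativeHeightExistence.lean`:

* `exists_isMultCanonical` — at an odd NON-split multiplicative prime `p` of the globally minimal
  `W/ℚ` there is a symmetric bilinear torsion-vanishing pairing `Dh : PAdicHeightData W p` whose
  quadratic form on every admissible point is SW's formula (4.1) read through the Tate curve,
  `heightFourOne W p q` (`q` the Tate parameter);
* `exists_isSplitMultCanonical` — the same at a SPLIT multiplicative prime with SW's modified height
  `heightSplit W p Dq` (`= heightFourOne - log_p(u)²/log_p(q_E)`).

Cell `bsd-eis` (HOME `run/shared/lean/pub/bsd-eis/`), seat `bsd-eis-k5-c4` g3: these two facts are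
the conjuncts `hHs`/`hHn` of `stub_publishedFacts` of crux 4 `BSDpOnCellC`
(stmt-BirchSwinnertonDyer-19034, route `EisensteinPrimes`, line b1) and the route's asides
stmt-…-19474 / -19475; they are also carried by the X11a chain, `Partition/CornersMult*`,
`ClassRecordThree`, `KolyvaginRoadThree` and the `Rank1Residual/Typed` certificates. HONEST FRAMING:
nothing here is a class theorem and nothing here is "finishing BSD".

## What is proved

The GOOD-ORDINARY twin `WeierstrassCurve.exists_isCanonical` is a theorem of the tree
(`CanonicalPAdicHeightHolds.lean`), by an argument whose algebraic half is reduction-type free: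
Jordan–von Neumann on the admissible subgroup and injectivity of `ℚ_p` as a `ℤ`-module
(`Literature.NumberTheory.EllipticCurves.exists_pairing_of_parallelogram`), the upgrade from the
generic to the full parallelogram law on a torsion-free subgroup
(`Literature.NumberTheory.EllipticCurves.parallelogram_of_generic`), the admissible locus with `O`
is the subgroup `E₁(ℚ_p) ⊓ ⨅_ℓ E₀(ℚ_ℓ)` for odd `p` and ANY `ℤ`-integral equation
(`WeierstrassCurve.exists_addSubgroup_coe_eq_localConditionsLocus`), `E₁(ℚ_p)` is torsion-free for
odd `p` (`not_isOfFinAddOrder_of_one_lt_padicNorm_holds`, AEC IV.6.1), and Néron's denominator law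
`den x(P+Q) · den x(P-Q) = den x(P)² den x(Q)² (x(P) - x(Q))²` at generic pairs reducing
non-singularly everywhere (`den_mul_den_eq` + `padicValNat_den_parallelogram_holds`, ATAEC VI.4.1).
Only the SIGMA side is reduction-type specific. At a multiplicative prime SW's (4.1) reads
`ĥ_p(P) = log_p(den x(P)) - log_p S(P)` with the Tate sigma quantity

  `S(P) = C² · σ_q(u(P))² = uniformisationScaleSq W p q · tateSigmaSq q (coshOfSq (logUnitParamSq W p q x y))`

(`MultiplicativeLeadingTerm.lean`: `C` the uniformisation scale `ψ^*ω_E = C du/u`, `u(P)` the Tate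
parameter of `P`, entered through `log_p(u(P))² = log_E(z(P))²/C²` and `cosh`). This file proves:

* `heightFourOne_parallelogram_of_theta` — IF `S` does not vanish on the rational points of
  `E₁(ℚ_p)` and satisfies the (squared) THETA RELATION at generic rational pairs of `E₁(ℚ_p)`,
  `S(P+Q) · S(P-Q) = (x(Q) - x(P))² · S(P)² · S(Q)²`, then `heightFourOne W p q` satisfies the
  parallelogram law on generic admissible pairs (computation: `d₃d₄ = d₁²d₂²δ²`,
  `S₃S₄ = δ²S₁²S₂²`, `log_p` multiplicative — the tree's theorem `padicLog_mul_holds`);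
* `logUnitParamSq_parallelogram` — the split correction `log_p(u(P))² = log_E(z(P))²/C²` satisfies
  the parallelogram law on generic rational pairs of `E₁(ℚ_p)` UNCONDITIONALLY: `P ↦ log_E(z(P))` is
  additive on `E₁(ℚ_p)` by the tree's theorems `formalGroupLaw_padicEval_holds` (AEC VII.2.2) and
  `padicFormalLog_padicEval₂_formalGroupLaw` (AEC IV.6.4(a)); hence
  `heightSplit_parallelogram_of_theta`;
* `exists_isMultCanonical_of_theta`, `exists_isSplitMultCanonical_of_theta` — **the two named facts
  from the single analytic input** (non-vanishing + theta relation of `S` at the rational points of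
  `E₁(ℚ_p)`, for `W` globally minimal, `p` odd multiplicative, `q` the Tate parameter), and the `∃!`
  corollaries (uniqueness is `IsMultCanonical.unique` / `IsSplitMultCanonical.unique`).

The analytic input is Silverman ATAEC **Prop. V.3.2 (b)(i)**,
`X(u₁,q) - X(u₂,q) = -u₂ θ(u₁u₂,q) θ(u₁u₂⁻¹,q)/(θ(u₁,q)² θ(u₂,q)²)` (with `σ_q(u)² = θ(u,q)²/u`,
tree `TateCurve.tateTheta`), read at the rational points of `E₁(ℚ_p)` through Tate's uniformisation
`E(ℚ_p) ⊇ E₀ ≅ R^*/…` (ATAEC V.3.1/V.5.3, tree `TateCurve.uniformization_holds`) in SW's coordinates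
(`log_E(z(P)) = C log_p u(P)`); it is NOT asserted here — it is the hypothesis `hΘ`, to be
discharged in the sequel (seat plan: complex identity = tree `weierstrassP_sub_eq_sigma_holds` +
`weierstrassSigma_ofUpperHalfPlane_eq_qProduct_holds`, `q`-transfer as in
`TateCurve/TateFormalAdditionIdentity.lean`).

## Sources

* W. Stein, C. Wuthrich, *Algorithms for the arithmetic of elliptic curves using Iwasawa theory*,
  Math. Comp. 82 (2013), §4 p. 14 (Bernardi: "this function is quadratic and satisfies the
  parallelogram law … induces a bilinear symmetric pairing"), §4.2 pp. 15–16 (the height at a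
  multiplicative prime), §6.1 p. 20. [SteinWuthrich2013]
* B. Mazur, W. Stein, J. Tate, Doc. Math. Extra Vol. Coates (2006), §1 ("extends uniquely"),
  §2.6–2.7 ("`h_ρ` is quadratic because of property IV of `σ`"). [MazurSteinTate2006]
* B. Mazur, J. Tate, *The `p`-adic sigma function*, Duke Math. J. 62 (1991), §3 (property IV, the
  theta relation, for ordinary — in particular Tate — curves). [MazurTate1991]
* J. H. Silverman, *Advanced Topics* (1994), Prop. V.3.2 (b) (PDF p. 399), Thm. V.3.1, Thm. V.5.3;
  Thm. VI.4.1, Ex. 6.3. [SilvermanATAEC1994]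
* J. H. Silverman, *AEC* (2009), IV.6.1, IV.6.4, VII.2.1–2.2. [SilvermanAEC2009]

## Design notes

* Pure proof file: no `def`, no named fact. The analytic input is an explicit hypothesis, stated on
  COORDINATES exactly as `heightFourOneCoord` reads them, in its two parts `hS0` (non-vanishing on
  `E(ℚ) ∩ E₁(ℚ_p)`) and `hΘ` (theta relation at generic pairs `x(P) ≠ x(Q)` of `E(ℚ) ∩ E₁(ℚ_p)`,
  with the sum and difference displayed as affine points); the global hypothesis of the two
  existence theorems quantifies it over the data of the named facts (`W` globally minimal, `p ≠ 2`
  multiplicative, `q ≠ 0`, `‖q‖ < 1`, `j(q) = j(W)`), so that its eventual proof may use all of them.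
* `p ≠ 2` is needed (as in the named facts) for: the sigma-disc clause of the admissible locus, the
  torsion-freeness of `E₁(ℚ_p)`, and (in the sequel) the convergence of `cosh ∘ log`.
* The split correction needs no minimality at `p`: integrality of `W ⊗ ℚ_p`
  (`isIntegral_padicInt_baseChange`) suffices for `formalGroupLaw_padicEval_holds` and
  `padicFormalLog_padicEval₂_formalGroupLaw`.
-/

noncomputable section

open scoped Classical

open WeierstrassCurve Literature.NumberTheory.EllipticCurves

namespace Literature.NumberTheory.EllipticCurves.SteinWuthrich2013

variable {W : WeierstrassCurve ℚ} {p : ℕ} [Fact p.Prime]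

/-! ### Unfolding the heights on affine points -/

/-- `heightFourOne` at `O` is `0` (SW's (4.1) at a multiplicative prime is read on affine points; `0`
at `O` by the transcription). [Stein–Wuthrich 2013, §4.2 (p. 15)] [cite: SteinWuthrich2013, §4.2 (p. 15)] -/
@[simp] theorem heightFourOne_zero (q : ℚ_[p]) : heightFourOne W p q 0 = 0 := rfl

/-- `heightFourOne` on an affine point is `heightFourOneCoord` (SW's formula (4.1) on coordinates).
[Stein–Wuthrich 2013, §4.1 eq. (4.1), §4.2 (p. 15)] [cite: SteinWuthrich2013, §4.2 (p. 15)] -/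
theorem heightFourOne_some (q : ℚ_[p]) {x y : ℚ} (h : W.toAffine.Nonsingular x y) :
    heightFourOne W p q (.some x y h) = heightFourOneCoord W p q x y := rfl

/-- `heightSplit` at `O` is `0` (the split-multiplicative height is read on affine points).
[Stein–Wuthrich 2013, §4.2 (p. 16)] [cite: SteinWuthrich2013, §4.2 (p. 16)] -/
@[simp] theorem heightSplit_zero [W.IsElliptic] (Dq : TateParameterData W p) :
    heightSplit W p Dq 0 = 0 := rfl

/-- `heightSplit` on an affine point is `heightSplitCoord` at `q = Dq.q` (SW's display
`ĥ_p(P) = 2 log_p(e(P)/σ_p(t(P))) - log_p(u)²/log_p(q_E)` on coordinates).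
[Stein–Wuthrich 2013, §4.2 (p. 16)] [cite: SteinWuthrich2013, §4.2 (p. 16)] -/
theorem heightSplit_some [W.IsElliptic] (Dq : TateParameterData W p) {x y : ℚ}
    (h : W.toAffine.Nonsingular x y) :
    heightSplit W p Dq (.some x y h) = heightSplitCoord W p Dq.q x y := rfl

/-! ### The split correction term is a quadratic function on `E(ℚ) ∩ E₁(ℚ_p)` (unconditional) -/

/-- **Additivity of `log_E ∘ z` on the rational points of `E₁(ℚ_p)`, on coordinates.** For a
`ℤ`-integral `W/ℚ`, any prime `p`, and `P = (x₁,y₁)`, `Q = (x₂,y₂) ∈ E(ℚ)` with `‖x₁‖_p, ‖x₂‖_p > 1`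
whose sum is the affine point `(x₃, y₃)`: `log_E(-x₃/y₃) = log_E(-x₁/y₁) + log_E(-x₂/y₂)`, where
`log_E` is the `p`-adic formal logarithm of `W ⊗ ℚ_p` (`padicFormalLog`). Proof: `z(P+Q) = F(z(P), z(Q))`
(`formalGroupLaw_padicEval_holds`, AEC VII.2.2) and `log_E(F(s,t)) = log_E s + log_E t`
(`padicFormalLog_padicEval₂_formalGroupLaw`, AEC IV.6.4(a)). [Silverman AEC VII.2.2, IV.6.4(a)]
[cite: SilvermanAEC2009, VII.2.2 and IV.6.4(a)] -/
theorem padicFormalLog_param_add [W.IsElliptic] [W.IsIntegral ℤ] {x₁ y₁ x₂ y₂ x₃ y₃ : ℚ}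
    (h₁ : W.toAffine.Nonsingular x₁ y₁) (h₂ : W.toAffine.Nonsingular x₂ y₂)
    (h₃ : W.toAffine.Nonsingular x₃ y₃) (hx₁ : 1 < ‖(x₁ : ℚ_[p])‖) (hx₂ : 1 < ‖(x₂ : ℚ_[p])‖)
    (hS : (.some x₁ y₁ h₁ : W.toAffine.Point) + .some x₂ y₂ h₂ = .some x₃ y₃ h₃) :
    (W.baseChange ℚ_[p]).padicFormalLog (-(x₃ : ℚ_[p]) / y₃) =
      (W.baseChange ℚ_[p]).padicFormalLog (-(x₁ : ℚ_[p]) / y₁) +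
        (W.baseChange ℚ_[p]).padicFormalLog (-(x₂ : ℚ_[p]) / y₂) := by
  set V := W.baseChange ℚ_[p] with hVdef
  set ι := W.toPadicPoint p with hιdef
  have hιP : ι (.some x₁ y₁ h₁) = .some (x₁ : ℚ_[p]) (y₁ : ℚ_[p]) (nonsingular_ratCast h₁) :=
    toPadicPoint_some h₁
  have hιQ : ι (.some x₂ y₂ h₂) = .some (x₂ : ℚ_[p]) (y₂ : ℚ_[p]) (nonsingular_ratCast h₂) :=
    toPadicPoint_some h₂
  have hιR : ι (.some x₃ y₃ h₃) = .some (x₃ : ℚ_[p]) (y₃ : ℚ_[p]) (nonsingular_ratCast h₃) :=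
    toPadicPoint_some h₃
  have hkP : V.IsInReductionKernel (ι (.some x₁ y₁ h₁)) := by rw [hιP]; exact hx₁
  have hkQ : V.IsInReductionKernel (ι (.some x₂ y₂ h₂)) := by rw [hιQ]; exact hx₂
  have hzP : V.formalParameter (ι (.some x₁ y₁ h₁)) = -(x₁ : ℚ_[p]) / y₁ := by rw [hιP]; rfl
  have hzQ : V.formalParameter (ι (.some x₂ y₂ h₂)) = -(x₂ : ℚ_[p]) / y₂ := by rw [hιQ]; rfl
  have hzR : V.formalParameter (ι (.some x₃ y₃ h₃)) = -(x₃ : ℚ_[p]) / y₃ := by rw [hιR]; rfl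
  have hadd : padicEval₂ V.formalGroupLaw (-(x₁ : ℚ_[p]) / y₁) (-(x₂ : ℚ_[p]) / y₂) =
      -(x₃ : ℚ_[p]) / y₃ := by
    rw [← hzP, ← hzQ, formalGroupLaw_padicEval_holds p V _ _ hkP hkQ, ← map_add, hS, hzR]
  have hs : ‖-(x₁ : ℚ_[p]) / y₁‖ < 1 := by
    rw [← hzP]; exact V.norm_formalParameter_lt_one hkP
  have ht : ‖-(x₂ : ℚ_[p]) / y₂‖ < 1 := by
    rw [← hzQ]; exact V.norm_formalParameter_lt_one hkQ
  rw [← hadd]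
  exact V.padicFormalLog_padicEval₂_formalGroupLaw hs ht

/-- **The split correction `log_p(u(P))² = log_E(z(P))²/C²` satisfies the parallelogram law** on
generic rational pairs of `E₁(ℚ_p)`: for a `ℤ`-integral `W/ℚ`, any prime `p`, any `q`, and
`P = (x₁,y₁)`, `Q = (x₂,y₂) ∈ E(ℚ) ∩ E₁(ℚ_p)` with `P + Q = (x₃,y₃)`, `P - Q = (x₄,y₄)` affine and
`‖x₄‖_p > 1`: `ℓ(P+Q) + ℓ(P-Q) = 2ℓ(P) + 2ℓ(Q)` for `ℓ = logUnitParamSq W p q` (`log_E` is additive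
on `E₁(ℚ_p)`, `padicFormalLog_param_add`, and `(a+b)² + (a-b)² = 2a² + 2b²`).
[Stein–Wuthrich 2013, §4.2 (p. 16); Silverman AEC VII.2.2, IV.6.4(a)]
[cite: SteinWuthrich2013, §4.2 (p. 16)] [cite: SilvermanAEC2009, VII.2.2 and IV.6.4(a)] -/
theorem logUnitParamSq_parallelogram [W.IsElliptic] [W.IsIntegral ℤ] (q : ℚ_[p])
    {x₁ y₁ x₂ y₂ x₃ y₃ x₄ y₄ : ℚ} (h₁ : W.toAffine.Nonsingular x₁ y₁)
    (h₂ : W.toAffine.Nonsingular x₂ y₂) (h₃ : W.toAffine.Nonsingular x₃ y₃)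
    (h₄ : W.toAffine.Nonsingular x₄ y₄) (hx₁ : 1 < ‖(x₁ : ℚ_[p])‖) (hx₂ : 1 < ‖(x₂ : ℚ_[p])‖)
    (hx₄ : 1 < ‖(x₄ : ℚ_[p])‖)
    (hS : (.some x₁ y₁ h₁ : W.toAffine.Point) + .some x₂ y₂ h₂ = .some x₃ y₃ h₃)
    (hD : (.some x₁ y₁ h₁ : W.toAffine.Point) - .some x₂ y₂ h₂ = .some x₄ y₄ h₄) :
    logUnitParamSq W p q x₃ y₃ + logUnitParamSq W p q x₄ y₄ =
      2 * logUnitParamSq W p q x₁ y₁ + 2 * logUnitParamSq W p q x₂ y₂ := by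
  -- `ℓ₃ = ℓ₁ + ℓ₂` and, from `(P - Q) + Q = P`, `ℓ₁ = ℓ₄ + ℓ₂`
  have h3 := padicFormalLog_param_add (p := p) h₁ h₂ h₃ hx₁ hx₂ hS
  have hS' : (.some x₄ y₄ h₄ : W.toAffine.Point) + .some x₂ y₂ h₂ = .some x₁ y₁ h₁ := by
    rw [← hD, sub_add_cancel]
  have h4 := padicFormalLog_param_add (p := p) h₄ h₂ h₁ hx₄ hx₂ hS'
  unfold logUnitParamSq
  rw [h3, show (W.baseChange ℚ_[p]).padicFormalLog (-(x₄ : ℚ_[p]) / y₄) =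
    (W.baseChange ℚ_[p]).padicFormalLog (-(x₁ : ℚ_[p]) / y₁) -
      (W.baseChange ℚ_[p]).padicFormalLog (-(x₂ : ℚ_[p]) / y₂) by rw [h4]; ring]
  ring

/-! ### The parallelogram law of SW's (4.1) at a multiplicative prime from the theta relation of `S` -/

/-- **SW's formula (4.1) at a multiplicative prime satisfies the parallelogram law on generic
admissible pairs, GIVEN the theta relation of the Tate sigma quantity.** Let `W/ℚ` be globally
minimal, `p` an odd prime, `q ∈ ℚ_p`, and write
`S(x,y) = uniformisationScaleSq W p q · tateSigmaSq q (coshOfSq (logUnitParamSq W p q x y))`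
(`= C²σ_q(u(P))²`, so that `heightFourOneCoord = log_p(den x) - log_p S`). Assume (`hS0`) `S ≠ 0` at
every rational point of `E₁(ℚ_p)` and (`hΘ`) the theta relation
`S(P+Q) · S(P-Q) = (x(Q) - x(P))² · S(P)² · S(Q)²` at every pair of rational points of `E₁(ℚ_p)` with
`x(P) ≠ x(Q)`. Then for `P, Q` satisfying the local conditions with `P ≠ ±Q`:
`ĥ(P+Q) + ĥ(P-Q) = 2ĥ(P) + 2ĥ(Q)` for `ĥ = heightFourOne W p q`. Computation (MST 2006 §2.7 at a
Tate curve): `d₃d₄ = d₁²d₂²δ²` (`den_mul_den_eq`, `padicValNat_den_parallelogram_holds`),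
`S₃S₄ = δ²S₁²S₂²` (`hΘ`), and `log_p` is multiplicative (`padicLog_mul_holds`).
[Mazur–Stein–Tate 2006, §2.6–2.7; Stein–Wuthrich 2013, §4.2; Mazur–Tate 1991, §3 (property IV)]
[cite: SteinWuthrich2013, §4.2 (pp. 15–16)] -/
theorem heightFourOne_parallelogram_of_theta [W.IsElliptic] [W.IsGloballyMinimal] (hp2 : p ≠ 2)
    (q : ℚ_[p])
    (hS0 : ∀ {x y : ℚ} (_ : W.toAffine.Nonsingular x y), 1 < ‖(x : ℚ_[p])‖ →
      uniformisationScaleSq W p q * tateSigmaSq q (coshOfSq (logUnitParamSq W p q x y)) ≠ 0)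
    (hΘ : ∀ {x₁ y₁ x₂ y₂ x₃ y₃ x₄ y₄ : ℚ} (h₁ : W.toAffine.Nonsingular x₁ y₁)
      (h₂ : W.toAffine.Nonsingular x₂ y₂) (h₃ : W.toAffine.Nonsingular x₃ y₃)
      (h₄ : W.toAffine.Nonsingular x₄ y₄), 1 < ‖(x₁ : ℚ_[p])‖ → 1 < ‖(x₂ : ℚ_[p])‖ → x₁ ≠ x₂ →
      (.some x₁ y₁ h₁ : W.toAffine.Point) + .some x₂ y₂ h₂ = .some x₃ y₃ h₃ →
      (.some x₁ y₁ h₁ : W.toAffine.Point) - .some x₂ y₂ h₂ = .some x₄ y₄ h₄ →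
        (uniformisationScaleSq W p q * tateSigmaSq q (coshOfSq (logUnitParamSq W p q x₃ y₃))) *
            (uniformisationScaleSq W p q * tateSigmaSq q (coshOfSq (logUnitParamSq W p q x₄ y₄))) =
          ((x₂ : ℚ_[p]) - x₁) ^ 2 *
            (uniformisationScaleSq W p q * tateSigmaSq q (coshOfSq (logUnitParamSq W p q x₁ y₁))) ^ 2 *
            (uniformisationScaleSq W p q * tateSigmaSq q (coshOfSq (logUnitParamSq W p q x₂ y₂))) ^ 2)
    (P Q : W.toAffine.Point) (hP : W.SatisfiesLocalConditions p P)
    (hQ : W.SatisfiesLocalConditions p Q) (hsub : P - Q ≠ 0) (hadd : P + Q ≠ 0) :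
    heightFourOne W p q (P + Q) + heightFourOne W p q (P - Q) =
      2 * heightFourOne W p q P + 2 * heightFourOne W p q Q := by
  have hmul : padicLog_mul p := padicLog_mul_holds p
  -- the subgroup: `P ± Q` again satisfy the local conditions
  obtain ⟨H, hH⟩ := W.exists_addSubgroup_coe_eq_localConditionsLocus p hp2
  have hmem : ∀ R, R ∈ H ↔ R = 0 ∨ W.SatisfiesLocalConditions p R := fun R => by
    rw [← SetLike.mem_coe, hH]; rfl
  have hPH : P ∈ H := (hmem P).mpr (Or.inr hP)
  have hQH : Q ∈ H := (hmem Q).mpr (Or.inr hQ)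
  have hS' : W.SatisfiesLocalConditions p (P + Q) :=
    ((hmem _).mp (H.add_mem hPH hQH)).resolve_left hadd
  have hD' : W.SatisfiesLocalConditions p (P - Q) :=
    ((hmem _).mp (H.sub_mem hPH hQH)).resolve_left hsub
  -- coordinates of the four points
  rcases P with _ | ⟨x₁, y₁, h₁⟩
  · exact (W.not_satisfiesLocalConditions_zero p hP).elim
  rcases Q with _ | ⟨x₂, y₂, h₂⟩
  · exact (W.not_satisfiesLocalConditions_zero p hQ).elim
  have hx : x₁ ≠ x₂ := X_ne_of_sub_ne_zero_of_add_ne_zero h₁ h₂ hsub hadd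
  rcases hS : (.some x₁ y₁ h₁ : W.toAffine.Point) + .some x₂ y₂ h₂ with _ | ⟨x₃, y₃, h₃⟩
  · exact (hadd hS).elim
  rcases hD : (.some x₁ y₁ h₁ : W.toAffine.Point) - .some x₂ y₂ h₂ with _ | ⟨x₄, y₄, h₄⟩
  · exact (hsub hD).elim
  rw [hS] at hS'
  rw [hD] at hD'
  obtain ⟨hx₁, -, hns₁⟩ := hP
  obtain ⟨hx₂, -, hns₂⟩ := hQ
  obtain ⟨hx₃, -, hns₃⟩ := hS'
  obtain ⟨hx₄, -, hns₄⟩ := hD'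
  -- the theta relation and the denominator identity
  have hθ' := hΘ h₁ h₂ h₃ h₄ hx₁ hx₂ hx hS hD
  have hden' := den_mul_den_eq padicValNat_den_parallelogram_holds W h₁ h₂ h₃ h₄ hx hS hD
    fun ℓ hℓ => ⟨hns₁ ℓ hℓ, hns₂ ℓ hℓ, hns₃ ℓ hℓ, hns₄ ℓ hℓ⟩
  have hdenp : ((x₃.den : ℚ) : ℚ_[p]) * ((x₄.den : ℚ) : ℚ_[p]) =
      ((x₁.den : ℚ) : ℚ_[p]) ^ 2 * ((x₂.den : ℚ) : ℚ_[p]) ^ 2 * ((x₁ : ℚ_[p]) - x₂) ^ 2 := by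
    have := congrArg (fun r : ℚ => (r : ℚ_[p])) hden'
    push_cast at this ⊢
    exact this
  -- abbreviations and non-vanishing
  set S₁ := uniformisationScaleSq W p q * tateSigmaSq q (coshOfSq (logUnitParamSq W p q x₁ y₁))
    with hS₁def
  set S₂ := uniformisationScaleSq W p q * tateSigmaSq q (coshOfSq (logUnitParamSq W p q x₂ y₂))
    with hS₂def
  set S₃ := uniformisationScaleSq W p q * tateSigmaSq q (coshOfSq (logUnitParamSq W p q x₃ y₃))
    with hS₃def
  set S₄ := uniformisationScaleSq W p q * tateSigmaSq q (coshOfSq (logUnitParamSq W p q x₄ y₄))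
    with hS₄def
  have hσ₁ : S₁ ≠ 0 := hS0 h₁ hx₁
  have hσ₂ : S₂ ≠ 0 := hS0 h₂ hx₂
  have hσ₃ : S₃ ≠ 0 := hS0 h₃ hx₃
  have hσ₄ : S₄ ≠ 0 := hS0 h₄ hx₄
  have hd : ∀ x : ℚ, ((x.den : ℚ) : ℚ_[p]) ≠ 0 := fun x => by exact_mod_cast x.den_nz
  have hδ : (x₁ : ℚ_[p]) - x₂ ≠ 0 := sub_ne_zero.mpr (by exact_mod_cast hx)
  have hδ' : (x₂ : ℚ_[p]) - x₁ ≠ 0 := by rw [← neg_sub]; exact neg_ne_zero.mpr hδ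
  -- logarithms
  have hlogd : padicLog p ((x₃.den : ℚ) : ℚ_[p]) + padicLog p ((x₄.den : ℚ) : ℚ_[p]) =
      2 * padicLog p ((x₁.den : ℚ) : ℚ_[p]) + 2 * padicLog p ((x₂.den : ℚ) : ℚ_[p]) +
        2 * padicLog p ((x₁ : ℚ_[p]) - x₂) := by
    rw [← hmul (hd x₃) (hd x₄), hdenp, hmul (mul_ne_zero (pow_ne_zero 2 (hd x₁))
      (pow_ne_zero 2 (hd x₂))) (pow_ne_zero 2 hδ), hmul (pow_ne_zero 2 (hd x₁))
      (pow_ne_zero 2 (hd x₂)), padicLog_sq (hd x₁), padicLog_sq (hd x₂), padicLog_sq hδ]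
  have hlogσ : padicLog p S₃ + padicLog p S₄ =
      2 * padicLog p ((x₁ : ℚ_[p]) - x₂) + 2 * padicLog p S₁ + 2 * padicLog p S₂ := by
    rw [← hmul hσ₃ hσ₄, hθ', hmul (mul_ne_zero (pow_ne_zero 2 hδ') (pow_ne_zero 2 hσ₁))
      (pow_ne_zero 2 hσ₂), hmul (pow_ne_zero 2 hδ') (pow_ne_zero 2 hσ₁), padicLog_sq hσ₁,
      padicLog_sq hσ₂, padicLog_sq hδ', ← neg_sub, padicLog_neg hδ]
  rw [hS, hD]
  simp only [heightFourOne_some, heightFourOneCoord]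
  rw [← hS₁def, ← hS₂def, ← hS₃def, ← hS₄def]
  linear_combination hlogd - hlogσ

/-- **SW's split-multiplicative height satisfies the parallelogram law on generic admissible pairs,
GIVEN the theta relation of the Tate sigma quantity** (hypotheses as in
`heightFourOne_parallelogram_of_theta`, for `q = Dq.q`): `heightSplit = heightFourOne - log_p(u)²/log_p(q_E)`
and both terms satisfy the law (`heightFourOne_parallelogram_of_theta`,
`logUnitParamSq_parallelogram`). [Stein–Wuthrich 2013, §4.2 (p. 16)] [cite: SteinWuthrich2013, §4.2 (p. 16)] -/
theorem heightSplit_parallelogram_of_theta [W.IsElliptic] [W.IsGloballyMinimal] (hp2 : p ≠ 2)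
    (Dq : TateParameterData W p)
    (hS0 : ∀ {x y : ℚ} (_ : W.toAffine.Nonsingular x y), 1 < ‖(x : ℚ_[p])‖ →
      uniformisationScaleSq W p Dq.q * tateSigmaSq Dq.q (coshOfSq (logUnitParamSq W p Dq.q x y)) ≠ 0)
    (hΘ : ∀ {x₁ y₁ x₂ y₂ x₃ y₃ x₄ y₄ : ℚ} (h₁ : W.toAffine.Nonsingular x₁ y₁)
      (h₂ : W.toAffine.Nonsingular x₂ y₂) (h₃ : W.toAffine.Nonsingular x₃ y₃)
      (h₄ : W.toAffine.Nonsingular x₄ y₄), 1 < ‖(x₁ : ℚ_[p])‖ → 1 < ‖(x₂ : ℚ_[p])‖ → x₁ ≠ x₂ →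
      (.some x₁ y₁ h₁ : W.toAffine.Point) + .some x₂ y₂ h₂ = .some x₃ y₃ h₃ →
      (.some x₁ y₁ h₁ : W.toAffine.Point) - .some x₂ y₂ h₂ = .some x₄ y₄ h₄ →
        (uniformisationScaleSq W p Dq.q *
              tateSigmaSq Dq.q (coshOfSq (logUnitParamSq W p Dq.q x₃ y₃))) *
            (uniformisationScaleSq W p Dq.q *
              tateSigmaSq Dq.q (coshOfSq (logUnitParamSq W p Dq.q x₄ y₄))) =
          ((x₂ : ℚ_[p]) - x₁) ^ 2 *
            (uniformisationScaleSq W p Dq.q *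
              tateSigmaSq Dq.q (coshOfSq (logUnitParamSq W p Dq.q x₁ y₁))) ^ 2 *
            (uniformisationScaleSq W p Dq.q *
              tateSigmaSq Dq.q (coshOfSq (logUnitParamSq W p Dq.q x₂ y₂))) ^ 2)
    (P Q : W.toAffine.Point) (hP : W.SatisfiesLocalConditions p P)
    (hQ : W.SatisfiesLocalConditions p Q) (hsub : P - Q ≠ 0) (hadd : P + Q ≠ 0) :
    heightSplit W p Dq (P + Q) + heightSplit W p Dq (P - Q) =
      2 * heightSplit W p Dq P + 2 * heightSplit W p Dq Q := by
  have h41 := heightFourOne_parallelogram_of_theta hp2 Dq.q hS0 hΘ P Q hP hQ hsub hadd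
  -- the subgroup: `P ± Q` again satisfy the local conditions
  obtain ⟨H, hH⟩ := W.exists_addSubgroup_coe_eq_localConditionsLocus p hp2
  have hmem : ∀ R, R ∈ H ↔ R = 0 ∨ W.SatisfiesLocalConditions p R := fun R => by
    rw [← SetLike.mem_coe, hH]; rfl
  have hPH : P ∈ H := (hmem P).mpr (Or.inr hP)
  have hQH : Q ∈ H := (hmem Q).mpr (Or.inr hQ)
  have hD' : W.SatisfiesLocalConditions p (P - Q) :=
    ((hmem _).mp (H.sub_mem hPH hQH)).resolve_left hsub
  -- coordinates of the four points
  rcases P with _ | ⟨x₁, y₁, h₁⟩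
  · exact (W.not_satisfiesLocalConditions_zero p hP).elim
  rcases Q with _ | ⟨x₂, y₂, h₂⟩
  · exact (W.not_satisfiesLocalConditions_zero p hQ).elim
  rcases hS : (.some x₁ y₁ h₁ : W.toAffine.Point) + .some x₂ y₂ h₂ with _ | ⟨x₃, y₃, h₃⟩
  · exact (hadd hS).elim
  rcases hD : (.some x₁ y₁ h₁ : W.toAffine.Point) - .some x₂ y₂ h₂ with _ | ⟨x₄, y₄, h₄⟩
  · exact (hsub hD).elim
  rw [hS, hD] at h41
  rw [hD] at hD'
  have hℓ := logUnitParamSq_parallelogram (p := p) Dq.q h₁ h₂ h₃ h₄ hP.1 hQ.1 hD'.1 hS hD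
  rw [hS, hD]
  simp only [heightSplit_some, heightSplitCoord]
  simp only [heightFourOne_some] at h41
  have hsplit : logUnitParamSq W p Dq.q x₃ y₃ / padicLog p Dq.q +
      logUnitParamSq W p Dq.q x₄ y₄ / padicLog p Dq.q =
        2 * (logUnitParamSq W p Dq.q x₁ y₁ / padicLog p Dq.q) +
          2 * (logUnitParamSq W p Dq.q x₂ y₂ / padicLog p Dq.q) := by
    rw [← add_div, hℓ]; ring
  linear_combination h41 - hsplit

/-! ### The assembly: existence of the two Stein–Wuthrich §4.2 data from the theta relation -/

/-- **Existence of the §4.2 datum at an odd NON-split multiplicative prime (`exists_isMultCanonical`)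
from the theta relation of the Tate sigma quantity.** Hypothesis `hΘ`: for every globally minimal
elliptic `W/ℚ`, odd prime `p` of multiplicative reduction and `q ∈ ℚ_p` with `q ≠ 0`, `‖q‖ < 1`,
`j(q) = j(W)` (the Tate parameter), the quantity
`S(x,y) = uniformisationScaleSq W p q · tateSigmaSq q (coshOfSq (logUnitParamSq W p q x y))`
(`= C²σ_q(u(P))²`) is non-zero at every rational point of `E₁(ℚ_p)` and satisfies
`S(P+Q) · S(P-Q) = (x(Q) - x(P))² · S(P)² · S(Q)²` at every generic rational pair of `E₁(ℚ_p)` —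
Silverman ATAEC Prop. V.3.2 (b)(i) `X(u₁) - X(u₂) = -u₂θ(u₁u₂)θ(u₁u₂⁻¹)/(θ(u₁)²θ(u₂)²)`
(`σ_q(u)² = θ(u)²/u`) read through Tate's uniformisation of `E₁(ℚ_p)` (ATAEC V.3.1, V.5.3) in SW's
coordinates. Conclusion: the named fact `exists_isMultCanonical`. Proof: the parallelogram law on
generic admissible pairs (`heightFourOne_parallelogram_of_theta`) upgrades to the full law on the
admissible subgroup `E₁(ℚ_p) ⊓ ⨅ E₀(ℚ_ℓ)` (`exists_addSubgroup_coe_eq_localConditionsLocus`,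
torsion-free by `not_isOfFinAddOrder_of_one_lt_padicNorm_holds`,
`Literature.NumberTheory.EllipticCurves.parallelogram_of_generic`), which is the quadratic form of a
symmetric biadditive torsion-vanishing pairing on `E(ℚ)`
(`Literature.NumberTheory.EllipticCurves.exists_pairing_of_parallelogram`).
[Stein–Wuthrich 2013, §4 (p. 14) and §4.2; Mazur–Stein–Tate 2006, §1, §2.6–2.7; Silverman ATAEC
Prop. V.3.2 (b)] [cite: SteinWuthrich2013, §4.2 (pp. 15–16)]
[cite: SilvermanATAEC1994, Prop. V.3.2 (b) (PDF p. 399)] -/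
theorem exists_isMultCanonical_of_theta
    (hΘ : ∀ (W : WeierstrassCurve ℚ) [W.IsElliptic] [W.IsGloballyMinimal] (p : ℕ) [Fact p.Prime],
      p ≠ 2 → W.HasMultiplicativeReductionAtPrime p →
      ∀ q : ℚ_[p], q ≠ 0 → ‖q‖ < 1 → tateJ q = (W.j : ℚ_[p]) →
        (∀ {x y : ℚ} (_ : W.toAffine.Nonsingular x y), 1 < ‖(x : ℚ_[p])‖ →
          uniformisationScaleSq W p q * tateSigmaSq q (coshOfSq (logUnitParamSq W p q x y)) ≠ 0) ∧
        (∀ {x₁ y₁ x₂ y₂ x₃ y₃ x₄ y₄ : ℚ} (h₁ : W.toAffine.Nonsingular x₁ y₁)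
          (h₂ : W.toAffine.Nonsingular x₂ y₂) (h₃ : W.toAffine.Nonsingular x₃ y₃)
          (h₄ : W.toAffine.Nonsingular x₄ y₄), 1 < ‖(x₁ : ℚ_[p])‖ → 1 < ‖(x₂ : ℚ_[p])‖ → x₁ ≠ x₂ →
          (.some x₁ y₁ h₁ : W.toAffine.Point) + .some x₂ y₂ h₂ = .some x₃ y₃ h₃ →
          (.some x₁ y₁ h₁ : W.toAffine.Point) - .some x₂ y₂ h₂ = .some x₄ y₄ h₄ →
            (uniformisationScaleSq W p q * tateSigmaSq q (coshOfSq (logUnitParamSq W p q x₃ y₃))) *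
                (uniformisationScaleSq W p q *
                  tateSigmaSq q (coshOfSq (logUnitParamSq W p q x₄ y₄))) =
              ((x₂ : ℚ_[p]) - x₁) ^ 2 *
                (uniformisationScaleSq W p q *
                  tateSigmaSq q (coshOfSq (logUnitParamSq W p q x₁ y₁))) ^ 2 *
                (uniformisationScaleSq W p q *
                  tateSigmaSq q (coshOfSq (logUnitParamSq W p q x₂ y₂))) ^ 2)) :
    exists_isMultCanonical := by
  intro W _ _ p _ hp2 hmult _ q hq0 hq1 hj
  obtain ⟨hS0, hθ⟩ := hΘ W p hp2 hmult q hq0 hq1 hj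
  have hpar := heightFourOne_parallelogram_of_theta hp2 q hS0 hθ
  obtain ⟨H, hH⟩ := W.exists_addSubgroup_coe_eq_localConditionsLocus p hp2
  have hmem : ∀ P, P ∈ H ↔ P = 0 ∨ W.SatisfiesLocalConditions p P := fun P => by
    rw [← SetLike.mem_coe, hH]; rfl
  have hslc : ∀ P ∈ H, P ≠ 0 → W.SatisfiesLocalConditions p P := fun P hP h0 =>
    ((hmem P).mp hP).resolve_left h0
  -- `H` is torsion-free
  have htf' : ∀ P ∈ H, IsOfFinAddOrder P → P = 0 := by
    intro P hP hfin
    by_contra h0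
    have hP' := hslc P hP h0
    cases P with
    | zero => exact h0 rfl
    | some x y h =>
      exact not_isOfFinAddOrder_of_one_lt_padicNorm_holds W p
        (by have := (Fact.out : p.Prime).two_le; omega) h hP'.1 hfin
  -- the full parallelogram law on `H`
  have hfull := Literature.NumberTheory.EllipticCurves.parallelogram_of_generic H htf'
    (heightFourOne W p q) rfl fun P hP Q hQ hP0 hQ0 hPQ hPQ' =>
      hpar P Q (hslc P hP hP0) (hslc Q hQ hQ0) hPQ hPQ'
  obtain ⟨B, hsymm, htors, hdiag⟩ :=
    Literature.NumberTheory.EllipticCurves.exists_pairing_of_parallelogram H _ hfull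
  exact ⟨⟨B, hsymm, fun P Q hP => htors P Q hP⟩, fun P hP => hdiag P ((hmem P).mpr (Or.inr hP.2))⟩

/-- **Existence of the §4.2 datum at an odd SPLIT multiplicative prime
(`exists_isSplitMultCanonical`) from the same theta relation** (hypothesis `hΘ` as in
`exists_isMultCanonical_of_theta`, applied at `q = Dq.q`, split ⇒ multiplicative): the extra term
`-log_p(u)²/log_p(q_E)` is quadratic unconditionally (`logUnitParamSq_parallelogram`).
[Stein–Wuthrich 2013, §4 (p. 14), §4.2 (p. 16); Mazur–Stein–Tate 2006, §1, §2.6–2.7; Silverman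
ATAEC Prop. V.3.2 (b)] [cite: SteinWuthrich2013, §4.2 (pp. 15–16)]
[cite: SilvermanATAEC1994, Prop. V.3.2 (b) (PDF p. 399)] -/
theorem exists_isSplitMultCanonical_of_theta
    (hΘ : ∀ (W : WeierstrassCurve ℚ) [W.IsElliptic] [W.IsGloballyMinimal] (p : ℕ) [Fact p.Prime],
      p ≠ 2 → W.HasMultiplicativeReductionAtPrime p →
      ∀ q : ℚ_[p], q ≠ 0 → ‖q‖ < 1 → tateJ q = (W.j : ℚ_[p]) →
        (∀ {x y : ℚ} (_ : W.toAffine.Nonsingular x y), 1 < ‖(x : ℚ_[p])‖ →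
          uniformisationScaleSq W p q * tateSigmaSq q (coshOfSq (logUnitParamSq W p q x y)) ≠ 0) ∧
        (∀ {x₁ y₁ x₂ y₂ x₃ y₃ x₄ y₄ : ℚ} (h₁ : W.toAffine.Nonsingular x₁ y₁)
          (h₂ : W.toAffine.Nonsingular x₂ y₂) (h₃ : W.toAffine.Nonsingular x₃ y₃)
          (h₄ : W.toAffine.Nonsingular x₄ y₄), 1 < ‖(x₁ : ℚ_[p])‖ → 1 < ‖(x₂ : ℚ_[p])‖ → x₁ ≠ x₂ →
          (.some x₁ y₁ h₁ : W.toAffine.Point) + .some x₂ y₂ h₂ = .some x₃ y₃ h₃ →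
          (.some x₁ y₁ h₁ : W.toAffine.Point) - .some x₂ y₂ h₂ = .some x₄ y₄ h₄ →
            (uniformisationScaleSq W p q * tateSigmaSq q (coshOfSq (logUnitParamSq W p q x₃ y₃))) *
                (uniformisationScaleSq W p q *
                  tateSigmaSq q (coshOfSq (logUnitParamSq W p q x₄ y₄))) =
              ((x₂ : ℚ_[p]) - x₁) ^ 2 *
                (uniformisationScaleSq W p q *
                  tateSigmaSq q (coshOfSq (logUnitParamSq W p q x₁ y₁))) ^ 2 *
                (uniformisationScaleSq W p q *
                  tateSigmaSq q (coshOfSq (logUnitParamSq W p q x₂ y₂))) ^ 2)) :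
    exists_isSplitMultCanonical := by
  intro W _ _ p _ hp2 Dq
  obtain ⟨hS0, hθ⟩ := hΘ W p hp2 Dq.split.hasMultiplicativeReductionAtPrime Dq.q Dq.q_ne_zero
    Dq.norm_q_lt_one Dq.tateJ_eq
  have hpar := heightSplit_parallelogram_of_theta hp2 Dq hS0 hθ
  obtain ⟨H, hH⟩ := W.exists_addSubgroup_coe_eq_localConditionsLocus p hp2
  have hmem : ∀ P, P ∈ H ↔ P = 0 ∨ W.SatisfiesLocalConditions p P := fun P => by
    rw [← SetLike.mem_coe, hH]; rfl
  have hslc : ∀ P ∈ H, P ≠ 0 → W.SatisfiesLocalConditions p P := fun P hP h0 =>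
    ((hmem P).mp hP).resolve_left h0
  -- `H` is torsion-free
  have htf' : ∀ P ∈ H, IsOfFinAddOrder P → P = 0 := by
    intro P hP hfin
    by_contra h0
    have hP' := hslc P hP h0
    cases P with
    | zero => exact h0 rfl
    | some x y h =>
      exact not_isOfFinAddOrder_of_one_lt_padicNorm_holds W p
        (by have := (Fact.out : p.Prime).two_le; omega) h hP'.1 hfin
  -- the full parallelogram law on `H`
  have hfull := Literature.NumberTheory.EllipticCurves.parallelogram_of_generic H htf'
    (heightSplit W p Dq) rfl fun P hP Q hQ hP0 hQ0 hPQ hPQ' =>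
      hpar P Q (hslc P hP hP0) (hslc Q hQ hQ0) hPQ hPQ'
  obtain ⟨B, hsymm, htors, hdiag⟩ :=
    Literature.NumberTheory.EllipticCurves.exists_pairing_of_parallelogram H _ hfull
  exact ⟨⟨B, hsymm, fun P Q hP => htors P Q hP⟩, fun P hP => hdiag P ((hmem P).mpr (Or.inr hP.2))⟩


/-! ### Sign-restricted variants (the input only where each fact needs it) -/

/-- **`exists_isSplitMultCanonical` from the theta relation AT SPLIT PRIMES ONLY.** Same as
`exists_isSplitMultCanonical_of_theta`, but the analytic input (non-vanishing + theta relation of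
the Tate sigma quantity at the rational points of `E₁(ℚ_p)`) is required only for the data of the
fact itself: `W` globally minimal, `p ≠ 2`, and a Tate parameter datum `Dq : TateParameterData W p`
(split multiplicative reduction, `q = Dq.q`). This is the form to be discharged over `K = ℚ_p`
(`E ≅ E_q` over `ℚ_p` exactly in the split case, ATAEC V.5.3). [Stein–Wuthrich 2013, §4.2
(p. 16); Silverman ATAEC Prop. V.3.2 (b), Thm. V.5.3] [cite: SteinWuthrich2013, §4.2 (pp. 15–16)]
[cite: SilvermanATAEC1994, Prop. V.3.2 (b) (PDF p. 399)] -/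
theorem exists_isSplitMultCanonical_of_theta_split
    (hΘ : ∀ (W : WeierstrassCurve ℚ) [W.IsElliptic] [W.IsGloballyMinimal] (p : ℕ) [Fact p.Prime],
      p ≠ 2 → ∀ Dq : TateParameterData W p,
        (∀ {x y : ℚ} (_ : W.toAffine.Nonsingular x y), 1 < ‖(x : ℚ_[p])‖ →
          uniformisationScaleSq W p Dq.q *
            tateSigmaSq Dq.q (coshOfSq (logUnitParamSq W p Dq.q x y)) ≠ 0) ∧
        (∀ {x₁ y₁ x₂ y₂ x₃ y₃ x₄ y₄ : ℚ} (h₁ : W.toAffine.Nonsingular x₁ y₁)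
          (h₂ : W.toAffine.Nonsingular x₂ y₂) (h₃ : W.toAffine.Nonsingular x₃ y₃)
          (h₄ : W.toAffine.Nonsingular x₄ y₄), 1 < ‖(x₁ : ℚ_[p])‖ → 1 < ‖(x₂ : ℚ_[p])‖ → x₁ ≠ x₂ →
          (.some x₁ y₁ h₁ : W.toAffine.Point) + .some x₂ y₂ h₂ = .some x₃ y₃ h₃ →
          (.some x₁ y₁ h₁ : W.toAffine.Point) - .some x₂ y₂ h₂ = .some x₄ y₄ h₄ →
            (uniformisationScaleSq W p Dq.q *
                tateSigmaSq Dq.q (coshOfSq (logUnitParamSq W p Dq.q x₃ y₃))) *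
                (uniformisationScaleSq W p Dq.q *
                  tateSigmaSq Dq.q (coshOfSq (logUnitParamSq W p Dq.q x₄ y₄))) =
              ((x₂ : ℚ_[p]) - x₁) ^ 2 *
                (uniformisationScaleSq W p Dq.q *
                  tateSigmaSq Dq.q (coshOfSq (logUnitParamSq W p Dq.q x₁ y₁))) ^ 2 *
                (uniformisationScaleSq W p Dq.q *
                  tateSigmaSq Dq.q (coshOfSq (logUnitParamSq W p Dq.q x₂ y₂))) ^ 2)) :
    exists_isSplitMultCanonical := by
  intro W _ _ p _ hp2 Dq
  obtain ⟨hS0, hθ⟩ := hΘ W p hp2 Dq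
  have hpar := heightSplit_parallelogram_of_theta hp2 Dq hS0 hθ
  obtain ⟨H, hH⟩ := W.exists_addSubgroup_coe_eq_localConditionsLocus p hp2
  have hmem : ∀ P, P ∈ H ↔ P = 0 ∨ W.SatisfiesLocalConditions p P := fun P => by
    rw [← SetLike.mem_coe, hH]; rfl
  have hslc : ∀ P ∈ H, P ≠ 0 → W.SatisfiesLocalConditions p P := fun P hP h0 =>
    ((hmem P).mp hP).resolve_left h0
  have htf' : ∀ P ∈ H, IsOfFinAddOrder P → P = 0 := by
    intro P hP hfin
    by_contra h0
    have hP' := hslc P hP h0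
    cases P with
    | zero => exact h0 rfl
    | some x y h =>
      exact not_isOfFinAddOrder_of_one_lt_padicNorm_holds W p
        (by have := (Fact.out : p.Prime).two_le; omega) h hP'.1 hfin
  have hfull := Literature.NumberTheory.EllipticCurves.parallelogram_of_generic H htf'
    (heightSplit W p Dq) rfl fun P hP Q hQ hP0 hQ0 hPQ hPQ' =>
      hpar P Q (hslc P hP hP0) (hslc Q hQ hQ0) hPQ hPQ'
  obtain ⟨B, hsymm, htors, hdiag⟩ :=
    Literature.NumberTheory.EllipticCurves.exists_pairing_of_parallelogram H _ hfull
  exact ⟨⟨B, hsymm, fun P Q hP => htors P Q hP⟩, fun P hP => hdiag P ((hmem P).mpr (Or.inr hP.2))⟩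

/-- **`exists_isMultCanonical` from the theta relation AT NON-SPLIT PRIMES ONLY.** Same as
`exists_isMultCanonical_of_theta`, with the analytic input required only for the data of the fact
itself: `W` globally minimal, `p ≠ 2` of multiplicative NON-split reduction, `q ≠ 0`, `‖q‖ < 1`,
`j(q) = j(W)` (there `E ≅ E_q` only over the unramified quadratic extension of `ℚ_p`, ATAEC V.5.3 /
Cor. V.5.4 — the form to be discharged over an extension field). [Stein–Wuthrich 2013, §4.2
(p. 15); Silverman ATAEC Prop. V.3.2 (b), Cor. V.5.4] [cite: SteinWuthrich2013, §4.2 (pp. 15–16)]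
[cite: SilvermanATAEC1994, Prop. V.3.2 (b) (PDF p. 399)] -/
theorem exists_isMultCanonical_of_theta_nonsplit
    (hΘ : ∀ (W : WeierstrassCurve ℚ) [W.IsElliptic] [W.IsGloballyMinimal] (p : ℕ) [Fact p.Prime],
      p ≠ 2 → W.HasMultiplicativeReductionAtPrime p → ¬ W.HasSplitMultiplicativeReductionAtPrime p →
      ∀ q : ℚ_[p], q ≠ 0 → ‖q‖ < 1 → tateJ q = (W.j : ℚ_[p]) →
        (∀ {x y : ℚ} (_ : W.toAffine.Nonsingular x y), 1 < ‖(x : ℚ_[p])‖ →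
          uniformisationScaleSq W p q * tateSigmaSq q (coshOfSq (logUnitParamSq W p q x y)) ≠ 0) ∧
        (∀ {x₁ y₁ x₂ y₂ x₃ y₃ x₄ y₄ : ℚ} (h₁ : W.toAffine.Nonsingular x₁ y₁)
          (h₂ : W.toAffine.Nonsingular x₂ y₂) (h₃ : W.toAffine.Nonsingular x₃ y₃)
          (h₄ : W.toAffine.Nonsingular x₄ y₄), 1 < ‖(x₁ : ℚ_[p])‖ → 1 < ‖(x₂ : ℚ_[p])‖ → x₁ ≠ x₂ →
          (.some x₁ y₁ h₁ : W.toAffine.Point) + .some x₂ y₂ h₂ = .some x₃ y₃ h₃ →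
          (.some x₁ y₁ h₁ : W.toAffine.Point) - .some x₂ y₂ h₂ = .some x₄ y₄ h₄ →
            (uniformisationScaleSq W p q * tateSigmaSq q (coshOfSq (logUnitParamSq W p q x₃ y₃))) *
                (uniformisationScaleSq W p q *
                  tateSigmaSq q (coshOfSq (logUnitParamSq W p q x₄ y₄))) =
              ((x₂ : ℚ_[p]) - x₁) ^ 2 *
                (uniformisationScaleSq W p q *
                  tateSigmaSq q (coshOfSq (logUnitParamSq W p q x₁ y₁))) ^ 2 *
                (uniformisationScaleSq W p q *
                  tateSigmaSq q (coshOfSq (logUnitParamSq W p q x₂ y₂))) ^ 2)) :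
    exists_isMultCanonical := by
  intro W _ _ p _ hp2 hmult hns q hq0 hq1 hj
  obtain ⟨hS0, hθ⟩ := hΘ W p hp2 hmult hns q hq0 hq1 hj
  have hpar := heightFourOne_parallelogram_of_theta hp2 q hS0 hθ
  obtain ⟨H, hH⟩ := W.exists_addSubgroup_coe_eq_localConditionsLocus p hp2
  have hmem : ∀ P, P ∈ H ↔ P = 0 ∨ W.SatisfiesLocalConditions p P := fun P => by
    rw [← SetLike.mem_coe, hH]; rfl
  have hslc : ∀ P ∈ H, P ≠ 0 → W.SatisfiesLocalConditions p P := fun P hP h0 =>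
    ((hmem P).mp hP).resolve_left h0
  have htf' : ∀ P ∈ H, IsOfFinAddOrder P → P = 0 := by
    intro P hP hfin
    by_contra h0
    have hP' := hslc P hP h0
    cases P with
    | zero => exact h0 rfl
    | some x y h =>
      exact not_isOfFinAddOrder_of_one_lt_padicNorm_holds W p
        (by have := (Fact.out : p.Prime).two_le; omega) h hP'.1 hfin
  have hfull := Literature.NumberTheory.EllipticCurves.parallelogram_of_generic H htf'
    (heightFourOne W p q) rfl fun P hP Q hQ hP0 hQ0 hPQ hPQ' =>
      hpar P Q (hslc P hP hP0) (hslc Q hQ hQ0) hPQ hPQ'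
  obtain ⟨B, hsymm, htors, hdiag⟩ :=
    Literature.NumberTheory.EllipticCurves.exists_pairing_of_parallelogram H _ hfull
  exact ⟨⟨B, hsymm, fun P Q hP => htors P Q hP⟩, fun P hP => hdiag P ((hmem P).mpr (Or.inr hP.2))⟩

end Literature.NumberTheory.EllipticCurves.SteinWuthrich2013

end
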